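import Mathlib
import Summits.Ventures.HodgeRepro2.T6N5FockMain
import Summits.Ventures.HodgeRepro2.T6N5RichToyData

/-!
# T6N5FockBundle — the REAL-PLACE BUNDLE of a sign model: condition (b) at the real places of a rich N5 datum
from the displays BY NAME, packaged for the M2 composition (the «option 2» of the staged v7 drop-in, STATUS
l. 11832) — Tier 6, sub-step N5 (t6-p7)

`RealPlaceBundle ι` gathers, per place `v : ι`, the real-place data of both sides (`RA v` / `RB v` :
`N5RealPlace.RealData`), the (U(1),U(1)) K-type carriers `CA v` / `CB v` with their signs `sW` / `εψ`, and the
EX-class facts tying them — the calibration `εψ·sW = −1` (MEMO §10.2), the oddness of `m′_A`, the theta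
predicates read off the carriers (`thetaOf`), the half-line inequalities of the datum's torus weights (the
VERDICT's, p410050) — as DECLARED fields (data and elementary / EX facts; no display inside).  The DISPLAYS
stay outside as binders: `SignModel.realCondB_of_bundle` derives `S.RealCondB` for a sign model whose
real-place signs are the bundle's (`hS`, EX by construction) from `Hyp.BFGYYZ2025_Thm3_5` on the real-place
instances and `Hyp.KonnoKonno2007_Thm5_4_i_lines` / `Hyp.KonnoKonno2007_Fact5_1_compact` on the carriers,
each quantified over the real places of both sides — six display binders consumed BY NAME.  Non-vacuity:
`Toy.bundle` over `Unit` (the real datum `Toy.toyReal₁`, both lines W₊ of weight 1) with `Toy.bundle_joint`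
(every field and every display at once), and `Toy.toySign_eq_bundle` — t6-p7's accepted rich toy sign model
`N5RichToyData.toySign` IS the bundle's (`hS` for the v7 witness on `N5RichToyData.toyRich`, mechanical).
Definition lane; count-neutral.
§8(d): uses an L-value-free non-vanishing device: NO.
-/

namespace Summit.Ventures.HodgeRepro2.T6.N5Fock

open Summit.Ventures.HodgeRepro2.T6.N5LocalDatum Summit.Ventures.HodgeRepro2.T6.N5Rich
  Summit.Ventures.HodgeRepro2.T6.Hyp Summit.Ventures.HodgeRepro2.T6.N5RealPlace

/-- THE REAL-PLACE BUNDLE of a sign model over the places `ι`: the real-place data of both sides, the K-type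
carriers with their signs, and the EX-class facts tying them (calibration, oddness of `m′_A`, the theta
predicates read off the carriers, the half-line inequalities of the torus weights).  Data and declared facts
only — the displays are binders of `SignModel.realCondB_of_bundle`. -/
structure RealPlaceBundle (ι : Type*) where
  /-- the real-place data of side A at each place (used at the real places) -/
  RA : ι → RealData
  /-- the real-place data of side B at each place -/
  RB : ι → RealData
  /-- the K-type carrier of side A at each place -/
  CA : ι → KTypeCarrier
  /-- the K-type carrier of side B at each place -/
  CB : ι → KTypeCarrier
  /-- the sign of the skew-hermitian line W of side A at each place -/
  sWA : ι → ℤˣ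
  /-- the sign of the skew-hermitian line W of side B at each place -/
  sWB : ι → ℤˣ
  /-- the sign ε_ψ of the additive character at each place, side A -/
  εψA : ι → ℤˣ
  /-- the sign ε_ψ of the additive character at each place, side B -/
  εψB : ι → ℤˣ
  /-- the calibration ε_ψ · sW = −1 (MEMO §10.2; EX), side A -/
  hcalA : ∀ v, εψA v * sWA v = -1
  /-- the calibration, side B -/
  hcalB : ∀ v, εψB v * sWB v = -1
  /-- m′_A is odd (the weight of the splitting character; EX), side A -/
  hoddA : ∀ v, Odd (RA v).mA'
  /-- m′_A is odd, side B -/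
  hoddB : ∀ v, Odd (RB v).mA'
  /-- the theta predicate of side A is read off the carrier (EX: the §10.2 identification) -/
  hTA : ∀ v s w, (RA v).Theta s w ↔ thetaOf (CA v) (sWA v) (εψA v) (RA v).mA' s w
  /-- the theta predicate of side B is read off the carrier -/
  hTB : ∀ v s w, (RB v).Theta s w ↔ thetaOf (CB v) (sWB v) (εψB v) (RB v).mA' s w
  /-- the half-line inequalities of the torus weights, side A (the VERDICT's weights; EX / kernel) -/
  hHA : ∀ v i, (RA v).HalfLine i
  /-- the half-line inequalities, side B -/
  hHB : ∀ v i, (RB v).HalfLine i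

namespace RealPlaceBundle

variable {ι : Type*} (B : RealPlaceBundle ι)

/-- The sign model with the bundle's real-place signs over the finite data `kind` / `D` / `ξ`. -/
def signModel (kind : ι → PlaceKind) (D : ι → LocalSignDatum) (ξ : ∀ v, Fin 4 → (D v).Char) :
    SignModel ι :=
  SignModel.ofReal kind D ξ B.RA B.RB

/-- The conjugate-orthogonal Fock dictionary of side A at a place from the two KK07 displays on its carrier. -/
theorem fockDictCO_A (v : ι) (h54 : KonnoKonno2007_Thm5_4_i_lines (B.CA v))
    (h51 : KonnoKonno2007_Fact5_1_compact (B.CA v)) : (B.RA v).FockDictCO :=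
  fockDictCO_of_displays (B.RA v) (B.CA v) (B.sWA v) (B.εψA v) (B.hcalA v) (B.hoddA v) (B.hTA v) h54 h51

/-- The same on side B. -/
theorem fockDictCO_B (v : ι) (h54 : KonnoKonno2007_Thm5_4_i_lines (B.CB v))
    (h51 : KonnoKonno2007_Fact5_1_compact (B.CB v)) : (B.RB v).FockDictCO :=
  fockDictCO_of_displays (B.RB v) (B.CB v) (B.sWB v) (B.εψB v) (B.hcalB v) (B.hoddB v) (B.hTB v) h54 h51

end RealPlaceBundle

end Summit.Ventures.HodgeRepro2.T6.N5Fock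

namespace Summit.Ventures.HodgeRepro2.T6.N5Rich.SignModel

open Summit.Ventures.HodgeRepro2.T6.N5LocalDatum Summit.Ventures.HodgeRepro2.T6.N5Rich
  Summit.Ventures.HodgeRepro2.T6.Hyp Summit.Ventures.HodgeRepro2.T6.N5RealPlace
  Summit.Ventures.HodgeRepro2.T6.N5Fock

/-- CONDITION (b) AT THE REAL PLACES OF A SIGN MODEL FROM THE BUNDLE AND THE DISPLAYS BY NAME: for a sign
model `S` whose real-place signs are the bundle's (`hS`, EX by construction), the Epsilon Dichotomy on the
real-place instances of both sides and the two Konno–Konno displays on the carriers at the real places give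
`S.RealCondB` — the binder `hre` of `N5RichMain.N5_of_rich`. -/
theorem realCondB_of_bundle {ι : Type*} (S : SignModel ι) (B : RealPlaceBundle ι)
    (hS : S = B.signModel S.kind S.D S.ξ)
    (h35A : ∀ v, S.kind v = .re → BFGYYZ2025_Thm3_5 (B.RA v).toLocal)
    (h35B : ∀ v, S.kind v = .re → BFGYYZ2025_Thm3_5 (B.RB v).toLocal)
    (h54A : ∀ v, S.kind v = .re → KonnoKonno2007_Thm5_4_i_lines (B.CA v))
    (h54B : ∀ v, S.kind v = .re → KonnoKonno2007_Thm5_4_i_lines (B.CB v))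
    (h51A : ∀ v, S.kind v = .re → KonnoKonno2007_Fact5_1_compact (B.CA v))
    (h51B : ∀ v, S.kind v = .re → KonnoKonno2007_Fact5_1_compact (B.CB v)) :
    S.RealCondB := by
  rw [hS]
  exact realCondB_ofReal_CO S.kind S.D S.ξ B.RA B.RB h35A h35B
    (fun v hv => B.fockDictCO_A v (h54A v hv) (h51A v hv))
    (fun v hv => B.fockDictCO_B v (h54B v hv) (h51B v hv))
    (fun v _ i => B.hHA v i) (fun v _ i => B.hHB v i)

end Summit.Ventures.HodgeRepro2.T6.N5Rich.SignModel

namespace Summit.Ventures.HodgeRepro2.T6.N5Fock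

open Summit.Ventures.HodgeRepro2.T6.N5LocalDatum Summit.Ventures.HodgeRepro2.T6.N5Rich
  Summit.Ventures.HodgeRepro2.T6.Hyp Summit.Ventures.HodgeRepro2.T6.N5RealPlace

/-! ## Non-vacuity (README §10.5(ii)(c)/(d)) -/

namespace Toy

/-- The real-place datum with BOTH lines W₊ of torus weight 1 (`m′_A = 1`; the theta predicate read off the
half-line carrier; the root number of the weight-`j` character `+1` iff `1 ≤ j`): its real-place signs
`ω = ε = (+1, +1)` are those of t6-p7's accepted rich toy sign models. -/
def toyReal₁ : RealData where
  eps := fun β => if 1 ≤ Multiplicative.toAdd β then 1 else -1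
  mA' := 1
  Theta := thetaOf carrier (-1) 1 1
  sign := ![1, 1]
  ηu := 1
  χ := ![1, 1]

/-- The displayed Epsilon Dichotomy on `toyReal₁` (its `eps` / `Theta` / `m′_A` are `toyReal`'s, whose proof
does not look at the lines). -/
theorem toyReal₁_thm3_5 : BFGYYZ2025_Thm3_5 toyReal₁.toLocal := toyReal_thm3_5

/-- The half-line inequalities of `toyReal₁`: both lines W₊, `1 + 1 ≤ 2 · 1`. -/
theorem toyReal₁_halfLine (i : Fin 2) : toyReal₁.HalfLine i := by
  unfold RealData.HalfLine toyReal₁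
  fin_cases i <;> simp

/-- The bundle over any place set with `toyReal₁` and the half-line carrier on both sides at every place. -/
def bundle (ι : Type*) : RealPlaceBundle ι where
  RA := fun _ => toyReal₁
  RB := fun _ => toyReal₁
  CA := fun _ => carrier
  CB := fun _ => carrier
  sWA := fun _ => -1
  sWB := fun _ => -1
  εψA := fun _ => 1
  εψB := fun _ => 1
  hcalA := fun _ => by decide
  hcalB := fun _ => by decide
  hoddA := fun _ => ⟨0, by decide⟩
  hoddB := fun _ => ⟨0, by decide⟩
  hTA := fun _ _ _ => Iff.rfl
  hTB := fun _ _ _ => Iff.rfl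
  hHA := fun _ => toyReal₁_halfLine
  hHB := fun _ => toyReal₁_halfLine

/-- JOINT NON-VACUITY of `realCondB_of_bundle`: on the sign model BUILT on the bundle (`hS := rfl`) over the
toy's finite data, every display binder holds and (b) at the real places follows. -/
theorem bundle_joint {ι : Type*} (kind : ι → PlaceKind) (D : ι → LocalSignDatum)
    (ξ : ∀ v, Fin 4 → (D v).Char) :
    (∀ v, BFGYYZ2025_Thm3_5 ((bundle ι).RA v).toLocal) ∧
      (∀ v, BFGYYZ2025_Thm3_5 ((bundle ι).RB v).toLocal) ∧
      (∀ v, KonnoKonno2007_Thm5_4_i_lines ((bundle ι).CA v)) ∧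
      (∀ v, KonnoKonno2007_Fact5_1_compact ((bundle ι).CA v)) ∧
      ((bundle ι).signModel kind D ξ).RealCondB :=
  ⟨fun _ => toyReal₁_thm3_5, fun _ => toyReal₁_thm3_5, fun _ => carrier_kTypeHalfLine,
    fun _ => carrier_howeCompact,
    ((bundle ι).signModel kind D ξ).realCondB_of_bundle (bundle ι) rfl (fun _ _ => toyReal₁_thm3_5)
      (fun _ _ => toyReal₁_thm3_5) (fun _ _ => carrier_kTypeHalfLine) (fun _ _ => carrier_kTypeHalfLine)
      (fun _ _ => carrier_howeCompact) (fun _ _ => carrier_howeCompact)⟩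

/-- t6-p7's accepted rich toy sign model (`N5RichToyData.toySign`, the one finite non-split place `()`) IS the
bundle's sign model over its finite data — the binder `hS` of the v7 drop-in on the (ii)(d) witness
`R5 := N5RichToyData.toyRich`. -/
theorem toySign_eq_bundle :
    N5RichToyData.toySign = (bundle Unit).signModel N5RichToyData.toySign.kind
      N5RichToyData.toySign.D N5RichToyData.toySign.ξ := by
  unfold RealPlaceBundle.signModel SignModel.ofReal N5RichToyData.toySign bundle toyReal₁
  congr 1 <;> funext v i <;> fin_cases i <;> rfl

end Toy

end Summit.Ventures.HodgeRepro2.T6.N5Fock
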